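/-
Copyright (c) 2026 the pub-hodgecm-mathlib formalisation cell (harness21).  Prover seat hodgecm-mathlib-R90-C10-p01 (g4), R90-TF SLAB section S1 «Ch10-local» (base
R90-C10), h413 = `stmt-HodgeConjecture-24833`; U4 :182 wild socket (S-W), card (W-7) STEP 2 (S1 dealer R90-C10-plan (g3), 2026-09-05; census
`R90/R90-C10-p01/g4/CENSUS-W7.v1.md`): «THE DEFECT OF THE MINIMAL TRACE-ONE ELEMENT» — the bridge between the line's `t_min` currency (★ (W-0), ★ (O1)) and the
different-exponent currency `d` of ★ `IsRamifiedQuadraticDatum` (Track A (N-vol-wild) volumes).  2026-09-05.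
-/
import Summits.HodgeConjecture.HodgeConjecture.Theorems.R90S1WildTraceOneMinimal   -- ★ (W-0) p865099 (this seat): `exists_traceOne_min`, `one_le_valued_of_traceOne`, `traceOne_ne_zero`, `exists_traceOne_min_adic`, `valued_traceMin_eq_one_iff_not_wild`
import Summits.HodgeConjecture.HodgeConjecture.Theorems.F0P3cDyRamWildPlaceDatum     -- ★ `F0P3cDyRamWildPlaceDatum.exists_isRamifiedQuadraticDatum_of_placesOver` (the datum at every ramified CM place); brings ★ `UnitaryThreeFourFrameDefs` (`IsRamifiedQuadraticDatum`)
import Literature.NumberTheory.LocalFields.WildQuadraticDatumTrace                   -- ★ `WildQuadraticDatum.exists_v_le_add_map_eq`, `v_add_map_le_exp` (`Tr 𝔭_E^j = 𝔭_F^{⌊(j+d)∕2⌋}`, `j m : ℤ`), `map_varpi_ne`, `eq_succ_of_odd`, `d_le_succ_t`, `v_varpi_pow`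
import HarnessLib

/-!
# R90-TF · S1 (Rogawski 1990 Ch. 12, local) — (W-7) `R90S1WildTraceMinDefect`: `|t_min| = |ϖ_w|^{−(d−1)}` — the minimal trace-one element of a ramified quadratic datum has defect `d − 1`

Cell hodgecm-mathlib, slab R90-TF (director brief v2), section S1 «Ch10-local» (base R90-C10), crux h413 = stmt-HodgeConjecture-24833 (lane `--supports … --as helper`),
route `route-HodgeConjecture-HCCMUnconditional` (no route verbs).  U4 :182 wild socket (S-W), card (W-7) STEP 2 of the S1 dealer R90-C10-plan (g3) on this seat's census
`R90/R90-C10-p01/g4/CENSUS-W7.v1.md` (verdict: the wild BALL ∕ SKEW-BALL MASSES and the twisted-box Tonelli are ★ already — Track A «(D-RAM) FOUR-FRAME» (N-vol-wild) FILES 1–3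
`HeisenbergWildChartFibre` ∕ `HeisenbergWildFibreHaar` ∕ `HeisenbergWildLevelFibreVolume` of LH4-p10 (g5), keyed on ★ `IsRamifiedQuadraticDatum σ_w ϖ d t` — so the ONE
missing brick is the CURRENCY BRIDGE below).  THEOREMS ONLY (no `def`, no `instance`, no notation, no named fact, no `sorry`); ★-only imports.

THE POINT.  The (S-W) line runs on a MINIMAL trace-one element `t` (`t + σt = 1`, `|t| ≤ |a|` for every trace-one `a`: ★ (W-0) `exists_traceOne_min`, the `htmin` letter of
★ (O1) `K2E3ConcaveLevelIwahoriCharacterMin`, (W-0b), (W-3), the θ-CM twin, P-wild-1), and carries its size as a LETTER `hδ : |t|·|ϖ|^δ ≤ 1` (p05 (g3) (W-3)); the Track A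
volumes run on the different exponent `d` of the place datum `(σ_w, ϖ, d, t′)` (★ `IsRamifiedQuadraticDatum`: `|ϖ − σϖ| = |ϖ|^d`, `|2| = |ϖ|^{t′}`, fixed elements have even
valuation).  THIS FILE PROVES **`|t_min| = exp(d − 1)`** — Serre's `Tr(𝔭_E^j) = 𝔭_F^{⌊(j+d)∕2⌋}` read at `1 ∈ 𝔭_F^0`: a trace-one element of valuation `≤ exp(d − 1)` EXISTS (★
`WildQuadraticDatum.exists_v_le_add_map_eq` at `y := 1`, `j := 1 − d`, `m := 0`), and NO trace-one element has valuation `≤ exp(d − 2)` (★ `v_add_map_le_exp` at `j := 2 − d`,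
`m := 1` would give `|1| ≤ exp(−2)`).  Consequences: the defect letter is DISCHARGED with `δ := d − 1` as an EQUALITY (`|t_min|·|ϖ|^{d−1} = 1`); `1 < |t_min| ⟺ 2 ≤ d ⟺
|2| ≠ 1` (the (S-W) selector in datum currency); and p02 (g3)'s fibre criterion `|t_min|·|x|² ≤ exp(−a)` IS ★ FILE 1's `|x| ≤ exp(−⌊(a+d)∕2⌋)` (`two_mul_log_le_iff`, integers).
* §1 MODEL level (★ (O1)∕(W-0) frame `{K} [Field K] [Valued K ℤᵐ⁰]`, datum `hD : IsRamifiedQuadraticDatum σ ϖ d t′`): `exists_traceOne_valued_le_exp_of_datum`,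
  `exp_le_valued_of_traceOne_of_datum`, **`valued_traceMin_eq_exp`**, `valued_traceMin_mul_pow_eq_one_of_datum` (the `hδ` discharge), `exists_traceMin_of_datum`
  (★ (W-0) ∘ `σϖ ≠ ϖ`), `two_le_iff_valued_two_ne_one_of_datum`, `one_lt_valued_traceMin_iff_two_le_of_datum`, `valued_mul_sq_le_iff_of_datum` (t-criterion ⟺ d-criterion).
* §2 ADIC level at a ramified CM place `w ∣ v` (`he : e(w∣v) ≠ 1`, any uniformiser `ϖ`; datum by ★ `exists_isRamifiedQuadraticDatum_of_placesOver`):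
  **`exists_traceMin_valued_eq_exp_adic`** `: ∃ d t′ t, IsRamifiedQuadraticDatum σ_w ϖ d t′ ∧ t + σ_w t = 1 ∧ (∀ a, a + σ_w a = 1 → |t| ≤ |a|) ∧ |t| = exp(d − 1)`,
  `valued_traceMin_eq_exp_adic`, `two_le_iff_valued_two_ne_one_adic`.
* §3 PLACE-FREE `LocalRing L v` spelling (★ (W-0) `exists_traceOne_min_local`'s currency, the re-scoped (W-1) adapter's letter `htδ`): `traceMin_adic_of_traceMin_local`,
  **`valued_apply_traceMin_eq_exp_local (hD) (ht) (htmin) : Valued.v (t w) = exp (d − 1)`**, `exists_datum_valued_apply_traceMin_eq_exp_local (he) (ϖ) (hϖ)`.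

HONEST LABEL.  HC_CM is proved only modulo the 7 printed citations (2 remaining named inputs: hLiu418 = stmt-HodgeConjecture-24832, h413 = stmt-HodgeConjecture-24833) until
rung 0 closes; count-neutral INFRASTRUCTURE — pays NO socket; (S-W) stays the XL residual of :182; :182 ∕ C :88∕:98 ∕ A2′ OPEN; REL ≠ ★ ≠ BUILT.

## References
* [Serre1979] J.-P. Serre, *Local Fields*, GTM 67 (1979), Ch. III §3 Prop. 7 (`Tr 𝔟 ⊆ 𝔞 ⟺ 𝔟 ⊆ 𝔞𝒟⁻¹`, whence `Tr(𝔭_E^j) = 𝔭_F^{⌊(j+d)∕2⌋}`), Ch. III §6 Prop. 13 (`d ≤ 2e_F + 1`).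
* [Tits1979] J. Tits, *Reductive groups over local fields*, Proc. Sympos. Pure Math. 33 Part 1 (1979), §1.15 (the element of maximal valuation with trace one in wild
  quasi-split `SU₃`; its valuation is the defect of the root datum).
* [Rogawski1990] J. D. Rogawski, *Automorphic Representations of Unitary Groups in Three Variables*, Ann. of Math. Stud. 123 (1990), §4.9 p. 55, §12.2 p. 173.
-/

set_option autoImplicit false
-- the mandated namespace has the single-problem summit's repeated segment (`HodgeConjecture.HodgeConjecture`)
set_option linter.dupNamespace false

noncomputable section

open NumberField IsDedekindDomain
open scoped WithZero Valued
open Literature.NumberTheory Literature.NumberTheory.Automorphic Literature.NumberTheory.Automorphic.UnitaryGroup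
open Literature.NumberTheory.Automorphic.UnitaryThreeFourFrame (IsRamifiedQuadraticDatum)
open Summit.HodgeConjecture.HodgeConjecture.Cruxes.H413.F0P3cDyRamWildPlaceDatum (exists_isRamifiedQuadraticDatum_of_placesOver)
open Literature.NumberTheory.LocalFields

namespace Summit.HodgeConjecture.HodgeConjecture.R90.S1

/-! ## §1 MODEL level — a ramified quadratic datum `(σ, ϖ, d, t′)` on a discretely valued field -/

section Model

variable {K : Type} [Field K] [Valued K ℤᵐ⁰] {σ : K →+* K} {ϖ : K} {d t' : ℕ}   -- `K : Type` as in ★ `IsRamifiedQuadraticDatum`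

/-- **A trace-one element of valuation `≤ exp(d − 1)` EXISTS** for a ramified quadratic datum: `1 ∈ 𝔭_F^0 = Tr(𝔭_E^{1−d})` (★ `WildQuadraticDatum.exists_v_le_add_map_eq` at
`y := 1`, `m := 0`, `j := 1 − d`). [cite: Serre1979, Ch. III §3 Prop. 7] -/
theorem exists_traceOne_valued_le_exp_of_datum (hD : IsRamifiedQuadraticDatum σ ϖ d t') :
    ∃ x : K, x + σ x = 1 ∧ Valued.v x ≤ WithZero.exp ((d : ℤ) - 1) := by
  obtain ⟨hσ, _, hϖ, hfix, hd, _, ht⟩ := hD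
  obtain ⟨x, hx, h1⟩ := WildQuadraticDatum.exists_v_le_add_map_eq hσ hfix hϖ hd ht (y := 1) (map_one σ) (j := 1 - d) (m := 0)
    (by rw [mul_zero, neg_zero, WithZero.exp_zero, Valuation.map_one]) (by omega)
  exact ⟨x, h1, by rwa [show -(1 - (d : ℤ)) = (d : ℤ) - 1 by ring] at hx⟩

/-- **NO trace-one element has valuation below `exp(d − 1)`**: if `a + σa = 1` then `exp(d − 1) ≤ |a|` — else `|a| ≤ exp(d − 2) = exp(−(2 − d))` and `Tr(𝔭_E^{2−d}) ⊆ 𝔭_F`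
(★ `WildQuadraticDatum.v_add_map_le_exp` at `j := 2 − d`, `m := 1`) would give `|1| ≤ exp(−2)`. [cite: Serre1979, Ch. III §3 Prop. 7] [cite: Tits1979, §1.15] -/
theorem exp_le_valued_of_traceOne_of_datum (hD : IsRamifiedQuadraticDatum σ ϖ d t') {a : K} (ha : a + σ a = 1) :
    WithZero.exp ((d : ℤ) - 1) ≤ Valued.v a := by
  obtain ⟨hσ, _, hϖ, hfix, hd, _, ht⟩ := hD
  have h0 : Valued.v a ≠ 0 := (Valuation.ne_zero_iff _).2 (traceOne_ne_zero σ ha)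
  refine not_lt.1 fun hlt => ?_
  -- `|a| = exp n` with `n < d − 1`, so `|a| ≤ exp(−(2 − d))`
  have hle : Valued.v a ≤ WithZero.exp (-(2 - (d : ℤ))) := by
    rw [← WithZero.exp_log h0] at hlt ⊢
    rw [WithZero.exp_lt_exp] at hlt
    rw [WithZero.exp_le_exp]
    omega
  have h := WildQuadraticDatum.v_add_map_le_exp hσ hfix hϖ hd ht (j := 2 - d) (m := 1) hle (by omega)
  rw [ha, Valuation.map_one, ← WithZero.exp_zero, WithZero.exp_le_exp] at h
  omega

/-- **(W-7) `|t_min| = exp(d − 1)` — THE DEFECT OF THE MINIMAL TRACE-ONE ELEMENT IS `d − 1`.**  For a ramified quadratic datum `(σ, ϖ, d, t′)` and a MINIMAL trace-one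
element `t` (`t + σt = 1`, `|t| ≤ |a|` for all trace-one `a` — ★ (W-0)'s conclusion, ★ (O1)'s `htmin` letter): `|t| = exp(d − 1) = |ϖ|^{−(d−1)}`.  So `|t_min| = 1` at a tame
place (`d = 1`) and `|t_min| = exp(d − 1) > 1` at a wild one (`d ≥ 2`) — Serre's `Tr(𝔭_E^j) = 𝔭_F^{⌊(j+d)∕2⌋}` at the two critical exponents.
[cite: Serre1979, Ch. III §3 Prop. 7] [cite: Tits1979, §1.15] -/
theorem valued_traceMin_eq_exp (hD : IsRamifiedQuadraticDatum σ ϖ d t') {t : K} (ht : t + σ t = 1)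
    (htmin : ∀ a : K, a + σ a = 1 → Valued.v t ≤ Valued.v a) : Valued.v t = WithZero.exp ((d : ℤ) - 1) := by
  refine le_antisymm ?_ (exp_le_valued_of_traceOne_of_datum hD ht)
  obtain ⟨x, hx, hvx⟩ := exists_traceOne_valued_le_exp_of_datum hD
  exact (htmin x hx).trans hvx

/-- **THE DEFECT LETTER DISCHARGED: `|t_min|·|ϖ|^{d−1} = 1`** — the (W-3) letter `hδ : Valued.v t * Valued.v ϖ ^ δ ≤ 1` of p05 (g3) holds with `δ := d − 1`, as an equality.
[cite: Serre1979, Ch. III §3 Prop. 7] -/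
theorem valued_traceMin_mul_pow_eq_one_of_datum (hD : IsRamifiedQuadraticDatum σ ϖ d t') {t : K} (ht : t + σ t = 1)
    (htmin : ∀ a : K, a + σ a = 1 → Valued.v t ≤ Valued.v a) : Valued.v t * Valued.v ϖ ^ (d - 1) = 1 := by
  have h1d : 1 ≤ d := hD.2.2.2.2.2.1
  rw [valued_traceMin_eq_exp hD ht htmin, WildQuadraticDatum.v_varpi_pow hD.2.2.1, ← WithZero.exp_add, ← WithZero.exp_zero]
  congr 1
  push_cast [Nat.cast_sub h1d]
  ring

/-- The defect letter in `≤` form (p05 (g3) (W-3)'s `hδ` VERBATIM with `δ := d − 1`). [cite: Serre1979, Ch. III §3 Prop. 7] -/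
theorem valued_traceMin_mul_pow_le_one_of_datum (hD : IsRamifiedQuadraticDatum σ ϖ d t') {t : K} (ht : t + σ t = 1)
    (htmin : ∀ a : K, a + σ a = 1 → Valued.v t ≤ Valued.v a) : Valued.v t * Valued.v ϖ ^ (d - 1) ≤ 1 :=
  (valued_traceMin_mul_pow_eq_one_of_datum hD ht htmin).le

/-- **A MINIMAL trace-one element of a ramified quadratic datum EXISTS, with `|t| = exp(d − 1)`** (★ (W-0) `exists_traceOne_min` — `σ` is an isometric involution moving `ϖ`,
★ `WildQuadraticDatum.map_varpi_ne` — then §1). [cite: Serre1979, Ch. III §3 Prop. 7] [cite: Tits1979, §1.15] -/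
theorem exists_traceMin_of_datum (hD : IsRamifiedQuadraticDatum σ ϖ d t') :
    ∃ t : K, t + σ t = 1 ∧ (∀ a : K, a + σ a = 1 → Valued.v t ≤ Valued.v a) ∧ Valued.v t = WithZero.exp ((d : ℤ) - 1) := by
  obtain ⟨t, ht, htmin⟩ := exists_traceOne_min σ hD.1 hD.2.1 ⟨ϖ, WildQuadraticDatum.map_varpi_ne hD.2.2.1 hD.2.2.2.2.1⟩
  exact ⟨t, ht, htmin, valued_traceMin_eq_exp hD ht htmin⟩

/-- **`2 ≤ d ⟺ |2| ≠ 1`** for a ramified quadratic datum: `d` odd forces `d = t′ + 1` (★ `eq_succ_of_odd`), so `d = 1 ⟹ t′ = 0 ⟹ |2| = |ϖ|^0 = 1`; conversely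
`d ≤ t′ + 1` (★ `d_le_succ_t`), so `2 ≤ d ⟹ 1 ≤ t′ ⟹ |2| = |ϖ|^{t′} < 1`.  (The (S-W) socket's selector `|2|_w ≠ 1` in datum currency.) [cite: Serre1979, Ch. III §6 Prop. 13] -/
theorem two_le_iff_valued_two_ne_one_of_datum (hD : IsRamifiedQuadraticDatum σ ϖ d t') : 2 ≤ d ↔ Valued.v (2 : K) ≠ 1 := by
  obtain ⟨hσ, _, hϖ, hfix, hd, h1d, ht⟩ := hD
  have hϖ1 : Valued.v ϖ < 1 := by rw [hϖ, ← WithZero.exp_zero, WithZero.exp_lt_exp]; norm_num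
  constructor
  · intro h2 h21
    have hdt := WildQuadraticDatum.d_le_succ_t hσ hfix hϖ hd ht
    have ht1 : 1 ≤ t' := by omega
    rw [ht] at h21
    exact (pow_lt_one' hϖ1 (by omega)).ne h21
  · intro h2
    by_contra hlt
    have hd1 : d = 1 := by omega
    have hodd : Odd d := by rw [hd1]; exact odd_one
    have hsucc := WildQuadraticDatum.eq_succ_of_odd hσ hfix hϖ hd ht hodd
    have ht0 : t' = 0 := by omega
    rw [ht0, pow_zero] at ht
    exact h2 ht

/-- **`1 < |t_min| ⟺ 2 ≤ d`** (§1: `|t_min| = exp(d − 1)`). [cite: Serre1979, Ch. III §3 Prop. 7] -/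
theorem one_lt_valued_traceMin_iff_two_le_of_datum (hD : IsRamifiedQuadraticDatum σ ϖ d t') {t : K} (ht : t + σ t = 1)
    (htmin : ∀ a : K, a + σ a = 1 → Valued.v t ≤ Valued.v a) : 1 < Valued.v t ↔ 2 ≤ d := by
  rw [valued_traceMin_eq_exp hD ht htmin, ← WithZero.exp_zero, WithZero.exp_lt_exp]
  omega

/-- **`|t_min| = 1 ⟺ d = 1`** (the tame case). [cite: Serre1979, Ch. III §3 Prop. 7] -/
theorem valued_traceMin_eq_one_iff_eq_one_of_datum (hD : IsRamifiedQuadraticDatum σ ϖ d t') {t : K} (ht : t + σ t = 1)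
    (htmin : ∀ a : K, a + σ a = 1 → Valued.v t ≤ Valued.v a) : Valued.v t = 1 ↔ d = 1 := by
  have h1d : 1 ≤ d := hD.2.2.2.2.2.1
  rw [valued_traceMin_eq_exp hD ht htmin, ← WithZero.exp_zero, WithZero.exp_inj]
  omega

/-- **THE TWO FIBRE CRITERIA AGREE: `|t_min|·|x|² ≤ exp(−a) ⟺ |x| ≤ exp(−⌊(a+d)∕2⌋)`** — p02 (g3)'s census §5 form (t-currency) versus ★ Track A FILE 1
`HeisenbergWildChartFibre.v_apply_le_of_valued_heisZ_le` ∕ `exists_skew_valued_heisZ_le` (d-currency), by `|t_min| = exp(d − 1)` and integer bookkeeping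
(`2n + d − 1 ≤ −a ⟺ n ≤ −⌊(a+d)∕2⌋`, floor division in `ℤ`). [cite: Serre1979, Ch. III §3 Prop. 7] [cite: Tits1979, §1.15] -/
theorem valued_traceMin_mul_sq_le_iff_of_datum (hD : IsRamifiedQuadraticDatum σ ϖ d t') {t : K} (ht : t + σ t = 1)
    (htmin : ∀ a : K, a + σ a = 1 → Valued.v t ≤ Valued.v a) (x : K) (a : ℤ) :
    Valued.v t * (Valued.v x * Valued.v x) ≤ WithZero.exp (-a) ↔ Valued.v x ≤ WithZero.exp (-((a + d) / 2)) := by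
  rw [valued_traceMin_eq_exp hD ht htmin]
  rcases eq_or_ne x 0 with rfl | hx
  · simp
  · have h0 : Valued.v x ≠ 0 := (Valuation.ne_zero_iff _).2 hx
    rw [← WithZero.exp_log h0, ← WithZero.exp_add, ← WithZero.exp_add, WithZero.exp_le_exp, WithZero.exp_le_exp]
    omega

end Model

/-! ## §2 ADIC level — a ramified CM place `w ∣ v` (`e(w∣v) ≠ 1`), `σ_w := galAdicCompletionMap c hw`, any uniformiser `ϖ` -/

section Adic

variable (L : Type) [Field L] [NumberField L] [IsCMField L] (v : HeightOneSpectrum (𝓞 ↥(maximalRealSubfield L)))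
  (w : PlacesOver L v) (hw : IsCMField.complexConj L • w.1 = w.1)

/-- **(W-7) AT A RAMIFIED CM PLACE: the minimal trace-one element of `L_w ∕ L⁺_v` has `|t| = exp(d − 1)`, `d` the different exponent of the place datum** — for EVERY
uniformiser `ϖ` of `L_w` there are `d, t′` with ★ `IsRamifiedQuadraticDatum σ_w ϖ d t′` (★ `exists_isRamifiedQuadraticDatum_of_placesOver`) and a minimal trace-one `t`
with `|t| = exp(d − 1)` (§1).  Tame `w` (`|2|_w = 1`): `d = 1`, `|t| = 1`; wild `w`: `d ≥ 2`, `|t| > 1` (§1 `two_le_iff_valued_two_ne_one_of_datum`).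
[cite: Serre1979, Ch. III §3 Prop. 7, Ch. III §6 Prop. 13] [cite: Tits1979, §1.15] -/
theorem exists_traceMin_valued_eq_exp_adic (he : v.asIdeal.ramificationIdx' w.1.asIdeal ≠ 1) (ϖ : w.1.adicCompletion L)
    (hϖ : Valued.v ϖ = WithZero.exp (-1 : ℤ)) :
    ∃ (d t' : ℕ) (t : w.1.adicCompletion L), IsRamifiedQuadraticDatum (galAdicCompletionMap (L := L) (IsCMField.complexConj L) hw) ϖ d t' ∧
      t + galAdicCompletionMap (L := L) (IsCMField.complexConj L) hw t = 1 ∧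
      (∀ a : w.1.adicCompletion L, a + galAdicCompletionMap (L := L) (IsCMField.complexConj L) hw a = 1 → Valued.v t ≤ Valued.v a) ∧
      Valued.v t = WithZero.exp ((d : ℤ) - 1) := by
  obtain ⟨d, t', hD⟩ := exists_isRamifiedQuadraticDatum_of_placesOver L w hw he ϖ hϖ
  obtain ⟨t, ht, htmin, hv⟩ := exists_traceMin_of_datum hD
  exact ⟨d, t', t, hD, ht, htmin, hv⟩

/-- **The adic minimal trace-one element of ★ (W-0) `exists_traceOne_min_adic` has `|t| = exp(d − 1)` for ANY datum `(σ_w, ϖ, d, t′)` at the place** (so `d` does not depend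
on the uniformiser, and the (W-3) defect letter holds with `δ := d − 1`). [cite: Serre1979, Ch. III §3 Prop. 7] -/
theorem valued_traceMin_eq_exp_adic {ϖ : w.1.adicCompletion L} {d t' : ℕ}
    (hD : IsRamifiedQuadraticDatum (galAdicCompletionMap (L := L) (IsCMField.complexConj L) hw) ϖ d t') {t : w.1.adicCompletion L}
    (ht : t + galAdicCompletionMap (L := L) (IsCMField.complexConj L) hw t = 1)
    (htmin : ∀ a : w.1.adicCompletion L, a + galAdicCompletionMap (L := L) (IsCMField.complexConj L) hw a = 1 → Valued.v t ≤ Valued.v a) :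
    Valued.v t = WithZero.exp ((d : ℤ) - 1) :=
  valued_traceMin_eq_exp hD ht htmin

/-- **The different exponent is at least `2` exactly at the wild places**: for a datum at a ramified CM place, `2 ≤ d ⟺ |2|_w ≠ 1` (§1), i.e. `⟺ ¬ (v unramified ∨ |2|_w = 1)`
modulo `he` — the (S-W) socket's selectors. [cite: Serre1979, Ch. III §6 Prop. 13] -/
theorem two_le_iff_valued_two_ne_one_adic {ϖ : w.1.adicCompletion L} {d t' : ℕ}
    (hD : IsRamifiedQuadraticDatum (galAdicCompletionMap (L := L) (IsCMField.complexConj L) hw) ϖ d t') :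
    2 ≤ d ↔ Valued.v (2 : w.1.adicCompletion L) ≠ 1 :=
  two_le_iff_valued_two_ne_one_of_datum hD

end Adic

/-! ## §3 PLACE-FREE `LocalRing L v = Π_{w ∣ v} L_w` spelling (the currency ★ (W-0) `exists_traceOne_min_local` and (W-1) bind) -/

section Local

variable (L : Type) [Field L] [NumberField L] [IsCMField L] (v : HeightOneSpectrum (𝓞 ↥(maximalRealSubfield L)))
  (w : PlacesOver L v) (hw : IsCMField.complexConj L • w.1 = w.1)

include hw in
/-- **At a place `w` fixed by `c` (the only place above `v`), the place-free trace-one relation reads at `w`**: `a + (c ⊗ 1) a = 1 ⟹ a_w + σ_w a_w = 1`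
(★ `conjLocal_apply_eq_of_smul_eq`). [cite: CasselsFrohlichANT1967, Ch. VII §1.1] -/
theorem apply_add_galAdicCompletionMap_apply_eq_one_of_traceOne_local {a : LocalRing L v}
    (ha : a + conjLocal L (IsCMField.complexConj L) v a = 1) :
    a w + galAdicCompletionMap (L := L) (IsCMField.complexConj L) hw (a w) = 1 := by
  have h := congrFun ha w
  rwa [Pi.add_apply, Pi.one_apply, conjLocal_apply_eq_of_smul_eq (IsCMField.complexConj L) (IsCMField.complexConj_ne_one L) v w hw] at h

include hw in
/-- **Place-free minimality implies adic minimality at `w`**: if `t ∈ L ⊗ L⁺_v` is minimal among place-free trace-one elements (at the coordinate `w`), then `t_w` is minimal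
among the trace-one elements of `L_w` — every `a₀ ∈ L_w` with `a₀ + σ_w a₀ = 1` is the `w`-coordinate of the place-free trace-one element `update 0 w a₀` (`w` is the only
place above `v`, ★ `PlacesOver.eq_of_smul_eq`). [cite: CasselsFrohlichANT1967, Ch. VII §1.1, Prop. 1.2] -/
theorem traceMin_adic_of_traceMin_local {t : LocalRing L v}
    (htmin : ∀ a : LocalRing L v, a + conjLocal L (IsCMField.complexConj L) v a = 1 → Valued.v (t w) ≤ Valued.v (a w)) :
    ∀ a₀ : w.1.adicCompletion L, a₀ + galAdicCompletionMap (L := L) (IsCMField.complexConj L) hw a₀ = 1 → Valued.v (t w) ≤ Valued.v a₀ := by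
  classical
  intro a₀ ha₀
  have h := htmin (Function.update 0 w a₀) (by
    funext w'
    obtain rfl := (PlacesOver.eq_of_smul_eq (IsCMField.complexConj L) (IsCMField.complexConj_ne_one L) w hw w').symm
    rw [Pi.add_apply, Pi.one_apply, conjLocal_apply_eq_of_smul_eq (IsCMField.complexConj L) (IsCMField.complexConj_ne_one L) v w hw,
      Function.update_self]
    exact ha₀)
  rwa [Function.update_self] at h

include hw in
/-- **(W-7) PLACE-FREE: `|t_w| = exp(d − 1)`** for a place-free minimal trace-one element `t ∈ L ⊗ L⁺_v` (★ (W-0) `exists_traceOne_min_local`'s conclusion) and ANY ramified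
quadratic datum `(σ_w, ϖ, d, t′)` at the place `w` — the letter `htδ : Valued.v (t w) = exp (d − 1)` of the re-scoped (W-1) adapter (dealer R-S1-39 (2)), DISCHARGED.
[cite: Serre1979, Ch. III §3 Prop. 7] [cite: Tits1979, §1.15] -/
theorem valued_apply_traceMin_eq_exp_local {ϖ : w.1.adicCompletion L} {d t' : ℕ}
    (hD : IsRamifiedQuadraticDatum (galAdicCompletionMap (L := L) (IsCMField.complexConj L) hw) ϖ d t') {t : LocalRing L v}
    (ht : t + conjLocal L (IsCMField.complexConj L) v t = 1)
    (htmin : ∀ a : LocalRing L v, a + conjLocal L (IsCMField.complexConj L) v a = 1 → Valued.v (t w) ≤ Valued.v (a w)) :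
    Valued.v (t w) = WithZero.exp ((d : ℤ) - 1) :=
  valued_traceMin_eq_exp hD (apply_add_galAdicCompletionMap_apply_eq_one_of_traceOne_local L v w hw ht)
    (traceMin_adic_of_traceMin_local L v w hw htmin)

include hw in
/-- **(W-7) PLACE-FREE, datum-free**: at a RAMIFIED `w` (`e(w∣v) ≠ 1`), for every uniformiser `ϖ` there are `d, t′` with ★ `IsRamifiedQuadraticDatum σ_w ϖ d t′` and
`|t_w| = exp(d − 1)` for every place-free minimal trace-one `t` (★ `exists_isRamifiedQuadraticDatum_of_placesOver` + the above).
[cite: Serre1979, Ch. III §3 Prop. 7, Ch. III §6 Prop. 13] -/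
theorem exists_datum_valued_apply_traceMin_eq_exp_local (he : v.asIdeal.ramificationIdx' w.1.asIdeal ≠ 1) (ϖ : w.1.adicCompletion L)
    (hϖ : Valued.v ϖ = WithZero.exp (-1 : ℤ)) {t : LocalRing L v} (ht : t + conjLocal L (IsCMField.complexConj L) v t = 1)
    (htmin : ∀ a : LocalRing L v, a + conjLocal L (IsCMField.complexConj L) v a = 1 → Valued.v (t w) ≤ Valued.v (a w)) :
    ∃ d t' : ℕ, IsRamifiedQuadraticDatum (galAdicCompletionMap (L := L) (IsCMField.complexConj L) hw) ϖ d t' ∧ Valued.v (t w) = WithZero.exp ((d : ℤ) - 1) := by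
  obtain ⟨d, t', hD⟩ := exists_isRamifiedQuadraticDatum_of_placesOver L w hw he ϖ hϖ
  exact ⟨d, t', hD, valued_apply_traceMin_eq_exp_local L v w hw hD ht htmin⟩

end Local

end Summit.HodgeConjecture.HodgeConjecture.R90.S1

end
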